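import Literature.Combinatorics.SimpleGraph.GridFormulaCells
import Literature.Barriers.CriticalPhenomena.GridSAWGadgetsFromDrawnFamily
import Literature.Computability.Complexity.CodeFPBudgets
import HarnessLib

/-!
# The bookkeeping of the grid graph of a formula is typed polynomial time

Support for the machine half of `GridSAW.LOT2003_lemma4_gadgets` (Liśkiewicz–Ogihara–Toda 2003,
Lemma 4: "It is not hard to see that `R` is polynomial-time computable") for the grid-native
construction `GridFormulaCells.lean` (`Literature.Combinatorics.SimpleGraph.GridFormula`): every
layout function of that file is shown typed polynomial time on codes (`CodeFP`, `CodeFP.lean`),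
from the code `cnfC` of the input CNF (`GridSAWGadgetsFromDrawnFamily.lean`), so that the drawing
data of the construction can be assembled in the `CodeFP` algebra and fed to
`LOT2003_lemma4_gadgets_of_family` / `LOT2003_lemma4_gadgets_of_unitFamily` /
`LOT2003_lemma4_gadgets_of_drawings`:

* `codeFP_cols`, `codeFP_N`, `codeFP_uN` (the columns, their number in binary and in unary);
* `codeFP_insertNew`, `codeFP_firstOccs`, **`codeFP_varRows`**, `codeFP_V`, `codeFP_uV`,
  **`codeFP_rowOf`** (the rows: distinct variables in order of first occurrence, by a left fold
  whose accumulator is a sublist of the input, `foldl_insertNew_eq_append`);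
* `codeFP_varOf`, `codeFP_polOf` (the literal of a column; `varOf_eq`, `polOf_eq`);
* `tileTyN`, **`codeFP_tileTyN`** (the tile type `empty / tap / cross` as `0 / 1 / 2`);
* `codeFP_uVN`, `codeFP_uncells`, `codeFP_ncells`, `codeFP_tileCell`, `codeFP_clauseBead`;
* `cellTyN`, `cellTyN_cellTyAt`, **`codeFP_cellTyN`**, **`codeFP_cellsOfN`** (the chain of cell
  types `cellsOf ψ`, as numbers `bead / pc / pct ↦ 0 / 1 / 2`, over `List.range (ncells ψ)` with
  the unary budget `codeFP_uncells`).

## References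

* M. Liśkiewicz, M. Ogihara, S. Toda, TCS 304 (2003) 129–156, §3 (proof of Lemma 4: "It is not
  hard to see that `R` is polynomial-time computable").
* S. Arora, B. Barak, *Computational Complexity: A Modern Approach*, CUP 2009, §1.3 (closure of
  polynomial time under composition and bounded loops).
-/

namespace Literature.Barriers.CriticalPhenomena.GridSAW

namespace GridFormulaFP

open _root_.Computability Polynomial Literature.Computability.Complexity Literature.Computability.Complexity.CodeFP
open Literature.Combinatorics.SimpleGraph Literature.Combinatorics.SimpleGraph.GridFormula
open Literature.Combinatorics.SimpleGraph.GridCell (CellTy)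

/-! ### Columns -/

/-- **The columns** `cols ψ = ψ.flatten` (raw list of literals). [cite: AroraBarak2009, §1.3] -/
theorem codeFP_cols : CodeFP cnfC (rawE litC) cols :=
  (((flatten litC).comp (map₀ (rawOfList litC))).comp (rawOfList clauseC)).congr fun ψ => by
    simp [cols]

/-- The number of columns, in binary. [cite: AroraBarak2009, §1.3] -/
theorem codeFP_N : CodeFP cnfC natE N := ((natLength litC).comp codeFP_cols).congr fun _ => rfl

/-- The number of columns, in unary. [cite: AroraBarak2009, §1.3] -/
theorem codeFP_uN : CodeFP cnfC unE N := ((ulength litC).comp codeFP_cols).congr fun _ => rfl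

/-! ### Rows -/

/-- `firstOccs` is a left fold of `insertNew`. [folklore] -/
theorem firstOccs_eq_foldl (acc : List ℕ) (l : List ℕ) : firstOccs acc l = l.foldl insertNew acc := by
  induction l generalizing acc with
  | nil => rfl
  | cons x l ih => rw [firstOccs, List.foldl_cons, ih]

/-- The fold appends a sublist of the input to the accumulator. [folklore] -/
theorem foldl_insertNew_eq_append (acc : List ℕ) (l : List ℕ) :
    ∃ l' : List ℕ, l'.Sublist l ∧ l.foldl insertNew acc = acc ++ l' := by
  induction l generalizing acc with
  | nil => exact ⟨[], List.Sublist.slnil, by simp⟩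
  | cons x l ih =>
    rw [List.foldl_cons]
    by_cases hx : x ∈ acc
    · obtain ⟨l', hl', h⟩ := ih acc
      rw [insertNew, if_pos hx]
      exact ⟨l', hl'.cons x, h⟩
    · obtain ⟨l', hl', h⟩ := ih (acc ++ [x])
      rw [insertNew, if_neg hx, h]
      exact ⟨x :: l', hl'.cons_cons x, by simp⟩

/-- **`insertNew`** `(x, acc) ↦ if x ∈ acc then acc else acc ++ [x]`. [cite: AroraBarak2009, §1.3] -/
theorem codeFP_insertNew : CodeFP (pairE natE (rawE natE)) (rawE natE) (fun p => insertNew p.2 p.1) := by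
  have hm : CodeFP (pairE natE (rawE natE)) bitE (fun p => decide (p.1 ∈ p.2)) := mem natE_injective
  have hacc : CodeFP (pairE natE (rawE natE)) (rawE natE) (fun p => p.2) := snd _ _
  have hx : CodeFP (pairE natE (rawE natE)) (rawE natE) (fun p => [p.1]) := (rawSingleton natE).comp (fst _ _)
  have happ : CodeFP (pairE natE (rawE natE)) (rawE natE) (fun p => p.2 ++ [p.1]) :=
    ((rawAppend natE).comp (hacc.pair hx)).congr fun _ => rfl
  exact (hm.ite hacc happ).congr fun p => by
    unfold insertNew
    by_cases h : p.1 ∈ p.2 <;> simp [h]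

/-- **`firstOccs []`**: the distinct elements in order of first occurrence. [cite: AroraBarak2009, §1.3] -/
theorem codeFP_firstOccs : CodeFP (rawE natE) (rawE natE) (fun l => firstOccs [] l) := by
  have h := foldl₀ (eα := natE) (eβ := rawE natE) (step := fun (x : ℕ) (acc : List ℕ) => insertNew acc x) (b₀ := [])
    codeFP_insertNew X (fun l₁ l₂ => by
      obtain ⟨l', hl', h⟩ := foldl_insertNew_eq_append [] l₁
      rw [eval_X, show (l₁.foldl (fun b a => insertNew b a) []) = l₁.foldl insertNew [] from rfl, h, List.nil_append]
      exact length_rawE_le_of_sublist _ (hl'.trans (List.sublist_append_left l₁ l₂)))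
  exact h.congr fun l => by rw [firstOccs_eq_foldl]

/-- **The rows** `varRows ψ` (distinct variables in order of first occurrence). [cite: AroraBarak2009, §1.3] -/
theorem codeFP_varRows : CodeFP cnfC (rawE natE) varRows :=
  (codeFP_firstOccs.comp ((map₀ (fst natE bitE)).comp codeFP_cols)).congr fun _ => rfl

/-- The number of rows, in binary. [cite: AroraBarak2009, §1.3] -/
theorem codeFP_V : CodeFP cnfC natE V := ((natLength natE).comp codeFP_varRows).congr fun _ => rfl

/-- The number of rows, in unary. [cite: AroraBarak2009, §1.3] -/
theorem codeFP_uV : CodeFP cnfC unE V := ((ulength natE).comp codeFP_varRows).congr fun _ => rfl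

/-- **The row of a variable** `(ψ, x) ↦ rowOf ψ x`. [cite: AroraBarak2009, §1.3] -/
theorem codeFP_rowOf : CodeFP (pairE cnfC natE) natE (fun p => rowOf p.1 p.2) :=
  (codeFP_idxOf.comp ((snd _ _).pair (codeFP_varRows.comp (fst _ _)))).congr fun _ => rfl

/-! ### The literal of a column -/

/-- `varOf` through a list of naturals (default `0`, whose code is empty). [folklore] -/
theorem varOf_eq (ψ : CNF ℕ) (j : ℕ) : varOf ψ j = ((cols ψ).map Prod.fst).getD j 0 := by
  simp only [varOf, List.getD_eq_getElem?_getD, List.getElem?_map]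
  cases (cols ψ)[j]? <;> rfl

/-- **The variable of a column** `(ψ, j) ↦ varOf ψ j`. [cite: AroraBarak2009, §1.3] -/
theorem codeFP_varOf : CodeFP (pairE cnfC natE) natE (fun p => varOf p.1 p.2) := by
  have hl : CodeFP (pairE cnfC natE) (rawE natE) (fun p => (cols p.1).map Prod.fst) :=
    ((map₀ (fst natE bitE)).comp (codeFP_cols.comp (fst _ _))).congr fun _ => rfl
  exact ((rawGetD natE (d := 0) rfl).comp (hl.pair (snd _ _))).congr fun p => (varOf_eq p.1 p.2).symm

/-- The polarity of a literal as a number. [folklore] -/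
def polNat (l : Literal ℕ) : ℕ := if l.2 then 1 else 0

/-- `polOf` through a list of naturals. [folklore] -/
theorem polOf_eq (ψ : CNF ℕ) (j : ℕ) :
    polOf ψ j = if j < N ψ then decide (((cols ψ).map polNat).getD j 0 = 1) else true := by
  unfold polOf N
  by_cases hj : j < (cols ψ).length
  · rw [if_pos hj, List.getD_eq_getElem _ _ hj, List.getD_eq_getElem _ _ (by simpa using hj), List.getElem_map]
    cases hb : ((cols ψ)[j]).2 <;> simp [polNat, hb]
  · rw [if_neg hj, List.getD_eq_default _ _ (not_lt.1 hj)]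

/-- **The polarity of a column** `(ψ, j) ↦ polOf ψ j`. [cite: AroraBarak2009, §1.3] -/
theorem codeFP_polOf : CodeFP (pairE cnfC natE) bitE (fun p => polOf p.1 p.2) := by
  have hpn : CodeFP litC natE polNat := ((snd natE bitE).ite (const litC 1) (const litC 0)).congr fun _ => rfl
  have hl : CodeFP (pairE cnfC natE) (rawE natE) (fun p => (cols p.1).map polNat) :=
    ((map₀ hpn).comp (codeFP_cols.comp (fst _ _))).congr fun _ => rfl
  have hget : CodeFP (pairE cnfC natE) natE (fun p => ((cols p.1).map polNat).getD p.2 0) :=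
    ((rawGetD natE (d := 0) rfl).comp (hl.pair (snd _ _))).congr fun _ => rfl
  have heq : CodeFP (pairE cnfC natE) bitE (fun p => decide (((cols p.1).map polNat).getD p.2 0 = 1)) :=
    (natEq.comp (hget.pair (const _ 1))).congr fun _ => rfl
  have hlt : CodeFP (pairE cnfC natE) bitE (fun p => decide (p.2 < N p.1)) :=
    (natLt.comp ((snd _ _).pair (codeFP_N.comp (fst _ _)))).congr fun _ => rfl
  exact (hlt.ite heq (const _ true)).congr fun p => by
    rw [polOf_eq]
    by_cases h : p.2 < N p.1 <;> simp [h]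

/-! ### Tiles -/

/-- The tile type as a number: `empty ↦ 0`, `tap ↦ 1`, `cross ↦ 2`. [folklore] -/
def tileTyN : TileTy → ℕ
  | .empty => 0
  | .tap => 1
  | .cross => 2

/-- `tileTyN` is injective. [folklore] -/
theorem tileTyN_injective : Function.Injective tileTyN := by
  intro a b h; cases a <;> cases b <;> first | rfl | simp [tileTyN] at h

/-- `tileTyN t = 2` iff the tile is a crossing. [folklore] -/
theorem tileTyN_eq_two_iff {t : TileTy} : tileTyN t = 2 ↔ t = .cross := by
  cases t <;> simp [tileTyN]

/-- The tile type by comparisons. [folklore] -/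
theorem tileTyN_tileTy (ψ : CNF ℕ) (i j : ℕ) :
    tileTyN (tileTy ψ i j) = if i < rowOf ψ (varOf ψ j) then 0 else if i = rowOf ψ (varOf ψ j) then 1 else 2 := by
  unfold tileTy
  split_ifs <;> rfl

/-- **The type of a tile** `(ψ, i, j) ↦ tileTyN (tileTy ψ i j)`. [cite: AroraBarak2009, §1.3] -/
theorem codeFP_tileTyN : CodeFP (pairE cnfC (pairE natE natE)) natE (fun p => tileTyN (tileTy p.1 p.2.1 p.2.2)) := by
  have hv : CodeFP (pairE cnfC (pairE natE natE)) natE (fun p => varOf p.1 p.2.2) :=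
    (codeFP_varOf.comp ((fst _ _).pair (snd _ _).snd')).congr fun _ => rfl
  have hr : CodeFP (pairE cnfC (pairE natE natE)) natE (fun p => rowOf p.1 (varOf p.1 p.2.2)) :=
    (codeFP_rowOf.comp ((fst _ _).pair hv)).congr fun _ => rfl
  have hi : CodeFP (pairE cnfC (pairE natE natE)) natE (fun p => p.2.1) := (snd _ _).fst'
  have hlt : CodeFP (pairE cnfC (pairE natE natE)) bitE (fun p => decide (p.2.1 < rowOf p.1 (varOf p.1 p.2.2))) :=
    (natLt.comp (hi.pair hr)).congr fun _ => rfl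
  have heq : CodeFP (pairE cnfC (pairE natE natE)) bitE (fun p => decide (p.2.1 = rowOf p.1 (varOf p.1 p.2.2))) :=
    (natEq.comp (hi.pair hr)).congr fun _ => rfl
  exact (hlt.ite (const _ 0) (heq.ite (const _ 1) (const _ 2))).congr fun p => by
    rw [tileTyN_tileTy]
    by_cases h1 : p.2.1 < rowOf p.1 (varOf p.1 p.2.2)
    · simp [h1]
    · by_cases h2 : p.2.1 = rowOf p.1 (varOf p.1 p.2.2) <;> simp [h1, h2]

/-! ### Cells -/

/-- `V · N` in unary. [cite: AroraBarak2009, §1.3] -/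
theorem codeFP_uVN : CodeFP cnfC unE (fun ψ => V ψ * N ψ) :=
  ((ulength unitE).comp (unitsMul.comp ((replicateUnit.comp codeFP_uV).pair (replicateUnit.comp codeFP_uN)))).congr
    fun ψ => by simp

/-- **The number of cells, in unary** (the budget of the range below). [cite: AroraBarak2009, §1.3] -/
theorem codeFP_uncells : CodeFP cnfC unE ncells :=
  (unSucc.comp (unAdd.comp ((unAdd.comp ((unAdd.comp (codeFP_uVN.pair codeFP_uVN)).pair codeFP_uVN)).pair codeFP_uN))).congr
    fun ψ => by unfold ncells; ring

/-- The number of cells, in binary. [cite: AroraBarak2009, §1.3] -/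
theorem codeFP_ncells : CodeFP cnfC natE ncells := (natOfUn.comp codeFP_uncells).congr fun _ => rfl

/-- **The cell index of a tile cell** `(ψ, i, j, c) ↦ tileCell ψ i j c = 1 + 3 (i N + j) + c`. [cite: AroraBarak2009, §1.3] -/
theorem codeFP_tileCell :
    CodeFP (pairE cnfC (pairE natE (pairE natE natE))) natE (fun p => tileCell p.1 p.2.1 p.2.2.1 p.2.2.2) := by
  have hN : CodeFP (pairE cnfC (pairE natE (pairE natE natE))) natE (fun p => N p.1) := codeFP_N.comp (fst _ _)
  have hi : CodeFP (pairE cnfC (pairE natE (pairE natE natE))) natE (fun p => p.2.1) := (snd _ _).fst'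
  have hj : CodeFP (pairE cnfC (pairE natE (pairE natE natE))) natE (fun p => p.2.2.1) := (snd _ _).snd'.fst'
  have hc : CodeFP (pairE cnfC (pairE natE (pairE natE natE))) natE (fun p => p.2.2.2) := (snd _ _).snd'.snd'
  have h1 : CodeFP (pairE cnfC (pairE natE (pairE natE natE))) natE (fun p => p.2.1 * N p.1 + p.2.2.1) :=
    (natAdd.comp ((natMul.comp (hi.pair hN)).pair hj)).congr fun _ => rfl
  have h2 : CodeFP (pairE cnfC (pairE natE (pairE natE natE))) natE (fun p => 1 + 3 * (p.2.1 * N p.1 + p.2.2.1)) :=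
    (natAdd.comp ((const _ 1).pair (natMul.comp ((const _ 3).pair h1)))).congr fun _ => rfl
  exact (natAdd.comp (h2.pair hc)).congr fun _ => rfl

/-- **The cell index of a clause-row terminal** `(ψ, j) ↦ clauseBead ψ j = 1 + 3 V N + j`. [cite: AroraBarak2009, §1.3] -/
theorem codeFP_clauseBead : CodeFP (pairE cnfC natE) natE (fun p => clauseBead p.1 p.2) := by
  have hVN : CodeFP (pairE cnfC natE) natE (fun p => V p.1 * N p.1) :=
    (natMul.comp ((codeFP_V.comp (fst _ _)).pair (codeFP_N.comp (fst _ _)))).congr fun _ => rfl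
  have h1 : CodeFP (pairE cnfC natE) natE (fun p => 1 + 3 * (V p.1 * N p.1)) :=
    (natAdd.comp ((const _ 1).pair (natMul.comp ((const _ 3).pair hVN)))).congr fun _ => rfl
  exact (natAdd.comp (h1.pair (snd _ _))).congr fun _ => rfl

/-- The cell type as a number: `bead ↦ 0`, `pc ↦ 1`, `pct ↦ 2`. [folklore] -/
def cellTyN : CellTy → ℕ
  | .bead => 0
  | .pc => 1
  | .pct => 2

/-- `cellTyN` is injective. [folklore] -/
theorem cellTyN_injective : Function.Injective cellTyN := by
  intro a b h; cases a <;> cases b <;> first | rfl | simp [cellTyN] at h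

/-- The cell type by arithmetic. [folklore] -/
theorem cellTyN_cellTyAt (ψ : CNF ℕ) (k : ℕ) :
    cellTyN (cellTyAt ψ k) =
      if k = 0 then 0
      else if k < 1 + 3 * (V ψ * N ψ) then
        (if tileTyN (tileTy ψ ((k - 1) / 3 / N ψ) ((k - 1) / 3 % N ψ)) = 2 then
          (if (k - 1) % 3 = 0 then 1 else if (k - 1) % 3 = 1 then 2 else 1)
        else 0)
      else 0 := by
  unfold cellTyAt
  by_cases h0 : k = 0
  · simp [h0, cellTyN]
  rw [if_neg h0, if_neg h0]
  by_cases h1 : k < 1 + 3 * (V ψ * N ψ)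
  · rw [if_pos h1, if_pos h1]
    by_cases h2 : tileTy ψ ((k - 1) / 3 / N ψ) ((k - 1) / 3 % N ψ) = .cross
    · rw [if_pos h2, if_pos (tileTyN_eq_two_iff.2 h2)]
      split_ifs <;> rfl
    · rw [if_neg h2, if_neg (fun h => h2 (tileTyN_eq_two_iff.1 h))]
      rfl
  · rw [if_neg h1, if_neg h1]
    rfl

/-- **The type of a cell** `(ψ, k) ↦ cellTyN (cellTyAt ψ k)`. [cite: AroraBarak2009, §1.3] -/
theorem codeFP_cellTyN : CodeFP (pairE cnfC natE) natE (fun p => cellTyN (cellTyAt p.1 p.2)) := by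
  have hk : CodeFP (pairE cnfC natE) natE (fun p => p.2) := snd _ _
  have hN : CodeFP (pairE cnfC natE) natE (fun p => N p.1) := codeFP_N.comp (fst _ _)
  have hV : CodeFP (pairE cnfC natE) natE (fun p => V p.1) := codeFP_V.comp (fst _ _)
  have hb : CodeFP (pairE cnfC natE) natE (fun p => 1 + 3 * (V p.1 * N p.1)) :=
    (natAdd.comp ((const _ 1).pair (natMul.comp ((const _ 3).pair (natMul.comp (hV.pair hN)))))).congr fun _ => rfl
  have hkm : CodeFP (pairE cnfC natE) natE (fun p => p.2 - 1) := (natSub.comp (hk.pair (const _ 1))).congr fun _ => rfl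
  have hq : CodeFP (pairE cnfC natE) natE (fun p => (p.2 - 1) / 3) := (natDiv.comp (hkm.pair (const _ 3))).congr fun _ => rfl
  have hr : CodeFP (pairE cnfC natE) natE (fun p => (p.2 - 1) % 3) := (natMod.comp (hkm.pair (const _ 3))).congr fun _ => rfl
  have hi : CodeFP (pairE cnfC natE) natE (fun p => (p.2 - 1) / 3 / N p.1) := (natDiv.comp (hq.pair hN)).congr fun _ => rfl
  have hj : CodeFP (pairE cnfC natE) natE (fun p => (p.2 - 1) / 3 % N p.1) := (natMod.comp (hq.pair hN)).congr fun _ => rfl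
  have ht : CodeFP (pairE cnfC natE) natE (fun p => tileTyN (tileTy p.1 ((p.2 - 1) / 3 / N p.1) ((p.2 - 1) / 3 % N p.1))) :=
    (codeFP_tileTyN.comp ((fst _ _).pair (hi.pair hj))).congr fun _ => rfl
  have c0 : CodeFP (pairE cnfC natE) bitE (fun p => decide (p.2 = 0)) := (natEq.comp (hk.pair (const _ 0))).congr fun _ => rfl
  have c1 : CodeFP (pairE cnfC natE) bitE (fun p => decide (p.2 < 1 + 3 * (V p.1 * N p.1))) :=
    (natLt.comp (hk.pair hb)).congr fun _ => rfl
  have c2 : CodeFP (pairE cnfC natE) bitE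
      (fun p => decide (tileTyN (tileTy p.1 ((p.2 - 1) / 3 / N p.1) ((p.2 - 1) / 3 % N p.1)) = 2)) :=
    (natEq.comp (ht.pair (const _ 2))).congr fun _ => rfl
  have c3 : CodeFP (pairE cnfC natE) bitE (fun p => decide ((p.2 - 1) % 3 = 0)) := (natEq.comp (hr.pair (const _ 0))).congr fun _ => rfl
  have c4 : CodeFP (pairE cnfC natE) bitE (fun p => decide ((p.2 - 1) % 3 = 1)) := (natEq.comp (hr.pair (const _ 1))).congr fun _ => rfl
  have hinner : CodeFP (pairE cnfC natE) natE
      (fun p => if decide ((p.2 - 1) % 3 = 0) then 1 else if decide ((p.2 - 1) % 3 = 1) then 2 else 1) :=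
    c3.ite (const _ 1) (c4.ite (const _ 2) (const _ 1))
  exact (c0.ite (const _ 0) (c1.ite (c2.ite hinner (const _ 0)) (const _ 0))).congr fun p => by
    rw [cellTyN_cellTyAt]
    simp only [decide_eq_true_eq]

/-- **The chain of cell types** `ψ ↦ (cellsOf ψ).map cellTyN`, over `List.range (ncells ψ)` with the
unary budget `codeFP_uncells`. [cite: LiskiewiczOgiharaToda2003, §3 (proof of Lemma 4: "R is polynomial-time computable")] -/
theorem codeFP_cellsOfN : CodeFP cnfC (rawE natE) (fun ψ => (cellsOf ψ).map cellTyN) := by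
  have hr : CodeFP cnfC (rawE natE) (fun ψ => List.range (ncells ψ)) := (urange.comp codeFP_uncells).congr fun _ => rfl
  have hm := (map (σ := CNF ℕ) (eσ := cnfC) codeFP_cellTyN).comp ((CodeFP.id cnfC).pair hr)
  exact hm.congr fun ψ => by simp [cellsOf, List.map_map, Function.comp_def]

end GridFormulaFP

end Literature.Barriers.CriticalPhenomena.GridSAW
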